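import Mathlib
import Summits.Ventures.PercRepro2.Defs

/-!
# Typed three-copy disagreement sums: the pinning recursion for cubic forms
(blind cell PercRepro2, p1; `proofs/P1-TWOCOPY.md` §8)

The covariance form (HCOV) of the tie statement (lead g9, ADDENDUM 19/20) clears to a CUBIC form in
expectations, `Ĝ = G · D · P(Q) = ∑_{x,y,z} P(x) P(y) P(z) K(x,y,z)` — three independent copies. The
two-copy pinning recursion of `DisagreementSum.lean` extends verbatim with a **type** at each
constrained edge: for `F ⊆ E` and `τ : E → ℕ`,

  `triSum p F τ K = ∑_{x,y,z : openCount x y z e = τ e ∀ e ∈ F} weight p x · weight p y · weight p z · K x y z`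

(`openCount x y z e` = the number of the three copies in which `e` is open). For `e ∉ F`:

* `triSum_split`: `triSum p F τ K = ∑_{k < 4} triSum p (insert e F) (τ[e ↦ k]) K`;
* `triSum_zero` / `triSum_three`: the `k = 0` and `k = 3` pieces are `(1 − p e)³ · triSum p[e↦0] F τ K`
  and `(p e)³ · triSum p[e↦1] F τ K` (both copies pinned);
* `triSum_nonneg_of_pinned`: if every typed sum with all free edges pinned (`p e ∈ {0,1}` off `F`,
  types in `{1,2}` on `F`) is nonnegative, then every typed sum — in particular the cubic form
  `triSum p ∅ τ K` itself — is nonnegative for every weight vector with values in `[0,1]`.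

With the free edges pinned, `triSum p F τ K = ∏_{e ∈ F} p_e^{τ e} (1 − p_e)^{3 − τ e}` times the
weight-free count of triples agreeing with the pinned configuration off `F` and with the prescribed
open counts on `F` ("typed 3-colourings"), so the hypothesis is a purely combinatorial statement
about the minors (`P1-TWOCOPY.md` §8; census 0 negatives on 1.9M typed bases, n ≤ 6).
-/

namespace Summit.Ventures.PercRepro2

section TriDefs

variable {E : Type*} [Fintype E] [DecidableEq E] {R : Type*} [CommRing R]

/-- The number of the three copies in which the edge `e` is open. -/
def openCount (x y z : Config E) (e : E) : ℕ := (x e).toNat + (y e).toNat + (z e).toNat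

/-- The typed three-copy disagreement sum. -/
def triSum (p : E → R) (F : Finset E) (τ : E → ℕ) (K : Config E → Config E → Config E → R) : R :=
  ∑ x : Config E, ∑ y : Config E, ∑ z : Config E,
    if ∀ e ∈ F, openCount x y z e = τ e then weight p x * weight p y * weight p z * K x y z else 0

/-- With no constraint the typed sum is the cubic form `∑_{x,y,z} P(x) P(y) P(z) K(x,y,z)`. -/
lemma triSum_empty (p : E → R) (τ : E → ℕ) (K : Config E → Config E → Config E → R) :
    triSum p ∅ τ K = ∑ x : Config E, ∑ y : Config E, ∑ z : Config E,
      weight p x * weight p y * weight p z * K x y z := by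
  unfold triSum
  simp

omit [Fintype E] in
/-- The constraint on `insert e F` with the type updated at `e`, for `e ∉ F`. -/
lemma forall_insert_update_iff {F : Finset E} {e : E} (he : e ∉ F) (τ : E → ℕ) (k : ℕ)
    (x y z : Config E) :
    (∀ e' ∈ insert e F, openCount x y z e' = Function.update τ e k e') ↔
      (openCount x y z e = k ∧ ∀ e' ∈ F, openCount x y z e' = τ e') := by
  rw [Finset.forall_mem_insert, Function.update_self]
  constructor
  · rintro ⟨h1, h2⟩
    refine ⟨h1, fun e' he' => ?_⟩
    have hne : e' ≠ e := fun h => he (h ▸ he')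
    have := h2 e' he'
    rwa [Function.update_of_ne hne] at this
  · rintro ⟨h1, h2⟩
    refine ⟨h1, fun e' he' => ?_⟩
    have hne : e' ≠ e := fun h => he (h ▸ he')
    rw [Function.update_of_ne hne]
    exact h2 e' he'

omit [Fintype E] [DecidableEq E] in
/-- The open count of an edge is at most `3`. -/
lemma openCount_le_three (x y z : Config E) (e : E) : openCount x y z e ≤ 3 := by
  unfold openCount
  cases x e <;> cases y e <;> cases z e <;> simp

omit [Fintype E] [DecidableEq E] in
/-- Open count `0`: all three copies are closed. -/
lemma openCount_eq_zero_iff (x y z : Config E) (e : E) :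
    openCount x y z e = 0 ↔ x e = false ∧ y e = false ∧ z e = false := by
  unfold openCount
  cases x e <;> cases y e <;> cases z e <;> simp

omit [Fintype E] [DecidableEq E] in
/-- Open count `3`: all three copies are open. -/
lemma openCount_eq_three_iff (x y z : Config E) (e : E) :
    openCount x y z e = 3 ↔ x e = true ∧ y e = true ∧ z e = true := by
  unfold openCount
  cases x e <;> cases y e <;> cases z e <;> simp

/-- **Splitting at a free edge**: the typed sum over `F` is the sum over the four possible open
counts at `e ∉ F`. -/
theorem triSum_split (p : E → R) {F : Finset E} {e : E} (he : e ∉ F) (τ : E → ℕ)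
    (K : Config E → Config E → Config E → R) :
    triSum p F τ K = ∑ k ∈ Finset.range 4, triSum p (insert e F) (Function.update τ e k) K := by
  have hcomm : ∀ g : ℕ → Config E → Config E → Config E → R,
      (∑ k ∈ Finset.range 4, ∑ x : Config E, ∑ y : Config E, ∑ z : Config E, g k x y z) =
        ∑ x : Config E, ∑ y : Config E, ∑ z : Config E, ∑ k ∈ Finset.range 4, g k x y z := by
    intro g
    rw [Finset.sum_comm]
    refine Finset.sum_congr rfl fun x _ => ?_
    rw [Finset.sum_comm]
    refine Finset.sum_congr rfl fun y _ => ?_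
    rw [Finset.sum_comm]
  unfold triSum
  rw [hcomm]
  refine Finset.sum_congr rfl fun x _ => ?_
  refine Finset.sum_congr rfl fun y _ => ?_
  refine Finset.sum_congr rfl fun z _ => ?_
  have hiff : ∀ k : ℕ, (∀ e' ∈ insert e F, openCount x y z e' = Function.update τ e k e') ↔
      (openCount x y z e = k ∧ ∀ e' ∈ F, openCount x y z e' = τ e') :=
    fun k => forall_insert_update_iff he τ k x y z
  rw [Finset.sum_congr rfl (fun k _ => if_congr (hiff k) rfl rfl)]
  by_cases hF : ∀ e' ∈ F, openCount x y z e' = τ e'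
  · rw [if_pos hF]
    have hk : ∀ k : ℕ, (if openCount x y z e = k ∧ ∀ e' ∈ F, openCount x y z e' = τ e' then
        weight p x * weight p y * weight p z * K x y z else 0) =
        if openCount x y z e = k then weight p x * weight p y * weight p z * K x y z else 0 := by
      intro k
      exact if_congr (and_iff_left hF) rfl rfl
    rw [Finset.sum_congr rfl (fun k _ => hk k)]
    rw [Finset.sum_ite_eq (Finset.range 4) (openCount x y z e)]
    rw [if_pos (Finset.mem_range.mpr (Nat.lt_succ_of_le (openCount_le_three x y z e)))]
  · rw [if_neg hF]
    refine (Finset.sum_eq_zero fun k _ => ?_).symm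
    rw [if_neg (fun h => hF h.2)]

/-- The piece with open count `0` at `e ∉ F` is `(1 − p e)³` times the sum with `e` pinned closed. -/
theorem triSum_zero (p : E → R) {F : Finset E} {e : E} (he : e ∉ F) (τ : E → ℕ)
    (K : Config E → Config E → Config E → R) :
    triSum p (insert e F) (Function.update τ e 0) K =
      (1 - p e) ^ 3 * triSum (Function.update p e 0) F τ K := by
  unfold triSum
  simp only [Finset.mul_sum]
  refine Finset.sum_congr rfl fun x _ => ?_
  refine Finset.sum_congr rfl fun y _ => ?_
  refine Finset.sum_congr rfl fun z _ => ?_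
  have hiff := forall_insert_update_iff he τ 0 x y z
  rw [if_congr hiff rfl rfl]
  by_cases hF : ∀ e' ∈ F, openCount x y z e' = τ e'
  · rw [if_pos hF]
    have hx := weight_eq_pin p x e
    have hy := weight_eq_pin p y e
    have hz := weight_eq_pin p z e
    by_cases hc : openCount x y z e = 0
    · rw [if_pos ⟨hc, hF⟩]
      obtain ⟨hxe, hye, hze⟩ := (openCount_eq_zero_iff x y z e).mp hc
      rw [weight_update_one_of_eq_false p hxe] at hx
      rw [weight_update_one_of_eq_false p hye] at hy
      rw [weight_update_one_of_eq_false p hze] at hz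
      rw [hx, hy, hz]
      ring
    · rw [if_neg (fun h => hc h.1)]
      -- some copy is open at `e`: the pinned-closed weight vanishes
      have : x e = true ∨ y e = true ∨ z e = true := by
        rw [openCount_eq_zero_iff] at hc
        cases hxe : x e <;> cases hye : y e <;> cases hze : z e <;> simp_all
      rcases this with h | h | h
      · rw [weight_update_zero_of_eq_true p h]; ring
      · rw [weight_update_zero_of_eq_true p h]; ring
      · rw [weight_update_zero_of_eq_true p h]; ring
  · rw [if_neg hF, if_neg (fun h => hF h.2), mul_zero]

/-- The piece with open count `3` at `e ∉ F` is `(p e)³` times the sum with `e` pinned open. -/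
theorem triSum_three (p : E → R) {F : Finset E} {e : E} (he : e ∉ F) (τ : E → ℕ)
    (K : Config E → Config E → Config E → R) :
    triSum p (insert e F) (Function.update τ e 3) K =
      (p e) ^ 3 * triSum (Function.update p e 1) F τ K := by
  unfold triSum
  simp only [Finset.mul_sum]
  refine Finset.sum_congr rfl fun x _ => ?_
  refine Finset.sum_congr rfl fun y _ => ?_
  refine Finset.sum_congr rfl fun z _ => ?_
  have hiff := forall_insert_update_iff he τ 3 x y z
  rw [if_congr hiff rfl rfl]
  by_cases hF : ∀ e' ∈ F, openCount x y z e' = τ e'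
  · rw [if_pos hF]
    have hx := weight_eq_pin p x e
    have hy := weight_eq_pin p y e
    have hz := weight_eq_pin p z e
    by_cases hc : openCount x y z e = 3
    · rw [if_pos ⟨hc, hF⟩]
      obtain ⟨hxe, hye, hze⟩ := (openCount_eq_three_iff x y z e).mp hc
      rw [weight_update_zero_of_eq_true p hxe] at hx
      rw [weight_update_zero_of_eq_true p hye] at hy
      rw [weight_update_zero_of_eq_true p hze] at hz
      rw [hx, hy, hz]
      ring
    · rw [if_neg (fun h => hc h.1)]
      have : x e = false ∨ y e = false ∨ z e = false := by
        rw [openCount_eq_three_iff] at hc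
        cases hxe : x e <;> cases hye : y e <;> cases hze : z e <;> simp_all
      rcases this with h | h | h
      · rw [weight_update_one_of_eq_false p h]; ring
      · rw [weight_update_one_of_eq_false p h]; ring
      · rw [weight_update_one_of_eq_false p h]; ring
  · rw [if_neg hF, if_neg (fun h => hF h.2), mul_zero]

/-- **The typed pinning recursion** at a free edge `e ∉ F`. -/
theorem triSum_pin (p : E → R) {F : Finset E} {e : E} (he : e ∉ F) (τ : E → ℕ)
    (K : Config E → Config E → Config E → R) :
    triSum p F τ K = (1 - p e) ^ 3 * triSum (Function.update p e 0) F τ K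
      + (p e) ^ 3 * triSum (Function.update p e 1) F τ K
      + triSum p (insert e F) (Function.update τ e 1) K
      + triSum p (insert e F) (Function.update τ e 2) K := by
  rw [triSum_split p he τ K, Finset.sum_range_succ, Finset.sum_range_succ, Finset.sum_range_succ,
    Finset.sum_range_one, triSum_zero p he τ K, triSum_three p he τ K]
  ring

end TriDefs

section TriFracFree

variable {E : Type*} [Fintype E] [DecidableEq E] {R : Type*} [CommRing R] [DecidableEq R]

/-- The free fractional edges of `(p, F)` (as in `DisagreementSum.fracFree`). -/
def triFracFree (p : E → R) (F : Finset E) : Finset E :=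
  Finset.univ.filter fun e => e ∉ F ∧ p e ≠ 0 ∧ p e ≠ 1

/-- Membership in the free fractional edges. -/
lemma mem_triFracFree {p : E → R} {F : Finset E} {e : E} :
    e ∈ triFracFree p F ↔ e ∉ F ∧ p e ≠ 0 ∧ p e ≠ 1 := by
  simp [triFracFree]

/-- Pinning `e` removes it from the free fractional edges. -/
lemma triFracFree_update (p : E → R) (F : Finset E) (e : E) (c : R) (hc : c = 0 ∨ c = 1) :
    triFracFree (Function.update p e c) F = (triFracFree p F).erase e := by
  ext e'
  simp only [mem_triFracFree, Finset.mem_erase]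
  by_cases h : e' = e
  · subst h
    simp only [Function.update_self, ne_eq, not_true_eq_false, false_and, iff_false,
      not_and, not_not]
    intro _ h0
    rcases hc with hc | hc
    · exact absurd hc h0
    · exact hc
  · simp [h]

/-- Adding `e` to `F` removes it from the free fractional edges. -/
lemma triFracFree_insert (p : E → R) (F : Finset E) (e : E) :
    triFracFree p (insert e F) = (triFracFree p F).erase e := by
  ext e'
  simp only [mem_triFracFree, Finset.mem_erase, Finset.mem_insert, not_or]
  tauto

end TriFracFree

section TriReduction

variable {E : Type*} [Fintype E] [DecidableEq E] {R : Type*} [CommRing R] [LinearOrder R]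
  [IsStrictOrderedRing R]

/-- **Three-copy reduction theorem.** If every typed sum whose free edges are all pinned
(`p e ∈ {0,1}` off `F`) and whose types on `F` lie in `{1, 2}` is nonnegative, then every typed sum
with types in `{1, 2}` on `F` — in particular the cubic form `triSum p ∅ τ K` — is nonnegative, for
every weight vector with values in `[0, 1]`. -/
theorem triSum_nonneg_of_pinned (K : Config E → Config E → Config E → R)
    (hbase : ∀ (q : E → R) (G : Finset E) (σ : E → ℕ), (∀ e, 0 ≤ q e ∧ q e ≤ 1) →
      (∀ e, e ∉ G → q e = 0 ∨ q e = 1) → (∀ e ∈ G, σ e = 1 ∨ σ e = 2) → 0 ≤ triSum q G σ K)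
    (p : E → R) (hp : ∀ e, 0 ≤ p e ∧ p e ≤ 1) (F : Finset E) (τ : E → ℕ)
    (hτ : ∀ e ∈ F, τ e = 1 ∨ τ e = 2) : 0 ≤ triSum p F τ K := by
  generalize hn : (triFracFree p F).card = n
  induction n using Nat.strong_induction_on generalizing p F τ with
  | _ n ih =>
    by_cases h0 : triFracFree p F = ∅
    · apply hbase p F τ hp _ hτ
      intro e he
      by_contra hc
      rw [not_or] at hc
      have : e ∈ triFracFree p F := mem_triFracFree.mpr ⟨he, hc.1, hc.2⟩
      rw [h0] at this
      exact absurd this (Finset.notMem_empty e)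
    · obtain ⟨e, he⟩ := Finset.nonempty_iff_ne_empty.mpr h0
      have heF : e ∉ F := (mem_triFracFree.mp he).1
      have hlt : ((triFracFree p F).erase e).card < n := by
        rw [← hn]
        exact Finset.card_erase_lt_of_mem he
      have hp0 : ∀ e', 0 ≤ Function.update p e 0 e' ∧ Function.update p e 0 e' ≤ 1 := by
        intro e'
        by_cases h : e' = e
        · subst h; simp
        · rw [Function.update_of_ne h]; exact hp e'
      have hp1 : ∀ e', 0 ≤ Function.update p e 1 e' ∧ Function.update p e 1 e' ≤ 1 := by
        intro e'
        by_cases h : e' = e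
        · subst h; simp
        · rw [Function.update_of_ne h]; exact hp e'
      have hτ1 : ∀ e' ∈ insert e F, Function.update τ e 1 e' = 1 ∨ Function.update τ e 1 e' = 2 := by
        intro e' he'
        by_cases h : e' = e
        · subst h; simp
        · rw [Function.update_of_ne h]
          exact hτ e' (Finset.mem_of_mem_insert_of_ne he' h)
      have hτ2 : ∀ e' ∈ insert e F, Function.update τ e 2 e' = 1 ∨ Function.update τ e 2 e' = 2 := by
        intro e' he'
        by_cases h : e' = e
        · subst h; simp
        · rw [Function.update_of_ne h]
          exact hτ e' (Finset.mem_of_mem_insert_of_ne he' h)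
      have hc0 : (triFracFree (Function.update p e 0) F).card = ((triFracFree p F).erase e).card := by
        rw [triFracFree_update p F e 0 (Or.inl rfl)]
      have hc1 : (triFracFree (Function.update p e 1) F).card = ((triFracFree p F).erase e).card := by
        rw [triFracFree_update p F e 1 (Or.inr rfl)]
      have hc2 : (triFracFree p (insert e F)).card = ((triFracFree p F).erase e).card := by
        rw [triFracFree_insert]
      have h1 : 0 ≤ triSum (Function.update p e 0) F τ K := ih _ hlt _ hp0 F τ hτ hc0
      have h2 : 0 ≤ triSum (Function.update p e 1) F τ K := ih _ hlt _ hp1 F τ hτ hc1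
      have h3 : 0 ≤ triSum p (insert e F) (Function.update τ e 1) K :=
        ih _ hlt _ hp (insert e F) _ hτ1 hc2
      have h4 : 0 ≤ triSum p (insert e F) (Function.update τ e 2) K :=
        ih _ hlt _ hp (insert e F) _ hτ2 hc2
      rw [triSum_pin p heF τ K]
      have hpe := hp e
      have h1' : 0 ≤ (1 - p e) ^ 3 := by
        have : 0 ≤ 1 - p e := sub_nonneg.mpr hpe.2
        positivity
      have h2' : 0 ≤ (p e) ^ 3 := by
        have := hpe.1
        positivity
      have := mul_nonneg h1' h1
      have := mul_nonneg h2' h2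
      linarith

end TriReduction

end Summit.Ventures.PercRepro2
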